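import Mathlib
import Literature.NumberTheory.Transcendental.KirbyEDerivations
import Literature.NumberTheory.Transcendental.KirbyWeakSchanuelAx
import Literature.NumberTheory.Transcendental.SchanuelEclEmptyProofs
import Literature.NumberTheory.Transcendental.EclClosureOperatorProofs
import Literature.Barriers.Schanuel.AxSchanuelFunctionalNotNumerical
import Summits.Schanuel.Schanuel.Theorems.RigidCoreDefs
import Summits.Schanuel.Schanuel.Theorems.RigidCoreSchanuelOnLogFreeCoreTermGerm

/-!
# The generic-fibre theorems of line `generic-period-fibre` (crux `RigidCore.SchanuelOnLogFreeCore`)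

Crux `stmt-Schanuel-0970` (`Summit.Schanuel.Schanuel.Theses.RigidCore.SchanuelOnLogFreeCore`: Schanuel's
conjecture on the log-free core `C_EA = eaFibre (2πi)`), line `generic-period-fibre`; this file lands
the line's two DELIVERABLE THEOREMS (registered stubs `stub_noHiddenConstants`, `stub_genericFibre`,
signatures verbatim), both UNCONDITIONAL consequences of the term-germ stub C (`stub_termGerm`,
landed in `RigidCoreSchanuelOnLogFreeCoreTermGerm.lean`):

* **No hidden constants** (`mem_kernelFreeCore_of_mem_eaFibre_of_mem_dcl` = `stub_noHiddenConstants`):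
  at a generic parameter `ω ∉ dcl ∅` (Kirby's derivation closure, tree
  `Literature.NumberTheory.Transcendental.dcl`; `= ecl ∅` by Kirby 2010 Thm 1.1) every element of
  the fibre `F_ω` that lies in `dcl ∅` already lies in the kernel-free core `M = kernelFreeCore`.
  Proof: an E-derivation `D` with `D ω ≠ 0`; the `deriv`-closed family `𝒯 ∋ f` with `f ω = c`;
  `D c = 0 = f′(ω) · D ω` and inductively `f^{(k)}(ω) = 0` for `k ≥ 1`; Taylor on the disc
  (`Complex.hasSum_taylorSeries_on_ball`) makes `f` constant, so `c = f(α) ∈ F_α ≤ M` for an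
  algebraic `α` in the disc (`stub_eaFibre_le_kernelFreeCore`).
* **The generic-fibre theorem** (`relSchanuel_eaFibre_of_not_mem_dcl` = `stub_genericFibre`): at
  every generic `ω`, tuples from `F_ω` that are `ℚ`-linearly independent modulo `M` satisfy
  `n ≤ trdeg_M M(x, eˣ)` — RELATIVE SCHANUEL of the generic fibre over the kernel-free core. From
  no-hidden-constants and Kirby's relative Schanuel theorem over `ecl ∅` (tree, PROVED:
  `kirby_relative_schanuel_complex_holds`) by base change down to `M ≤ ℚ(ecl ∅)`.
* `two_pi_I_mem_dcl_empty`: WHY THE KERNEL FIBRE IS LEFT OVER — `2πi ∈ dcl ∅` (every E-derivation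
  kills the period), so the theorem is silent at `ω = 2πi`; that excluded instance is exactly stub B
  (`stub_periodGenericOverCore`) of the line, the crux's arithmetic residue (barrier
  `Literature.Barriers.Schanuel.AxSchanuelFunctionalNotNumerical`, USED not evaded).

Sources: idea card `generic-period-fibre`; Kirby, *Exponential algebraicity in exponential fields*,
Bull. LMS 42 (2010), Thm 1.1/1.2, §4, Prop 7.1–7.2 (arXiv:0810.4285); Bays–Kirby–Wilkie,
*A Schanuel property for exponentially transcendental powers*, Bull. LMS 42 (2010) Prop 2.1
(arXiv:0810.4457) for the real-line analogue of "derivations along terms".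
-/

noncomputable section

namespace Summit.Schanuel.Schanuel.Theorems.RigidCore

open Complex
open scoped BigOperators Topology

/-! ## The generic-fibre theorems (corollaries of stub C; formerly skeleton glue) -/

section GenericFibre

open Literature.NumberTheory.Transcendental IntermediateField Metric

/-- There is a `ℚ(i)`-rational (hence algebraic) point in every open disc. -/
theorem exists_isAlgebraic_mem_ball (ω : ℂ) {r : ℝ} (hr : 0 < r) :
    ∃ a ∈ Metric.ball ω r, IsAlgebraic ℚ a := by
  obtain ⟨p, hp₁, hp₂⟩ := exists_rat_btwn (show ω.re - r / 2 < ω.re + r / 2 by linarith)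
  obtain ⟨q, hq₁, hq₂⟩ := exists_rat_btwn (show ω.im - r / 2 < ω.im + r / 2 by linarith)
  refine ⟨(p : ℂ) + (q : ℂ) * Complex.I, ?_, ?_⟩
  · rw [Metric.mem_ball, dist_eq_norm]
    refine (Complex.norm_le_abs_re_add_abs_im _).trans_lt ?_
    have h1 : ((p : ℂ) + (q : ℂ) * Complex.I - ω).re = (p : ℝ) - ω.re := by simp
    have h2 : ((p : ℂ) + (q : ℂ) * Complex.I - ω).im = (q : ℝ) - ω.im := by simp
    rw [h1, h2]
    have h3 : |(p : ℝ) - ω.re| < r / 2 := abs_sub_lt_iff.mpr ⟨by linarith, by linarith⟩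
    have h4 : |(q : ℝ) - ω.im| < r / 2 := abs_sub_lt_iff.mpr ⟨by linarith, by linarith⟩
    linarith
  · have hp : IsAlgebraic ℚ (p : ℂ) := by
      rw [show (p : ℂ) = algebraMap ℚ ℂ p from (eq_ratCast _ p).symm]
      exact isAlgebraic_algebraMap p
    have hq : IsAlgebraic ℚ (q : ℂ) := by
      rw [show (q : ℂ) = algebraMap ℚ ℂ q from (eq_ratCast _ q).symm]
      exact isAlgebraic_algebraMap q
    have hI : IsAlgebraic ℚ Complex.I := by
      refine ⟨Polynomial.X ^ 2 + Polynomial.C 1, Polynomial.X_pow_add_C_ne_zero (by norm_num) 1, ?_⟩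
      simp [Complex.I_sq]
    exact hp.add (hq.mul hI)

/-- **NO HIDDEN CONSTANTS** (unconditional): at a generic parameter `ω ∉ dcl ∅` (Kirby's
derivation closure; `= ecl ∅` by Kirby 2010 Thm 1.1), every element of the fibre `F_ω` lying in
`dcl ∅` — in particular every exponentially algebraic one (`ecl_subset_dcl`) — already lies in the
kernel-free core `M`. Proof: an E-derivation `D` with `D ω ≠ 0`; the term family `𝒯 ∋ f` of
`stub_termGerm` with `f ω = c`; `D c = 0 = f′(ω)·Dω` and inductively all `f^{(k)}(ω)`, `k ≥ 1`,
vanish; Taylor on the disc makes `f` constant there, so `c = f(α) ∈ F_α ≤ M` for an algebraic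
`α` in the disc. (The kernel fibre `ω = 2πi ∈ dcl ∅` is excluded: barrier
`AxSchanuelFunctionalNotNumerical`, `two_pi_I_mem_dcl_empty`.) -/
theorem mem_kernelFreeCore_of_mem_eaFibre_of_mem_dcl {ω : ℂ} (hω : ω ∉ dcl (∅ : Set ℂ)) {c : ℂ}
    (hc : c ∈ eaFibre ω) (hcd : c ∈ dcl (∅ : Set ℂ)) : c ∈ kernelFreeCore := by
  -- an E-derivation moving `ω`
  obtain ⟨D, hD, hDω⟩ : ∃ D ∈ eDer ℂ (∅ : Set ℂ), D ω ≠ 0 := by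
    by_contra h
    push Not at h
    exact hω h
  have hDE : IsEDerivation D := hD.1
  obtain ⟨r, hr, 𝒯, ⟨f, hf𝒯, hfω⟩, h𝒯⟩ := stub_termGerm ω c hc
  -- every iterated derivative of `f` is again in the family
  have hiter : ∀ k, iteratedDeriv k f ∈ 𝒯 := by
    intro k
    induction k with
    | zero => rw [iteratedDeriv_zero]; exact hf𝒯
    | succ k ih => rw [iteratedDeriv_succ]; exact (h𝒯 _ ih).2.1
  -- all derivatives of positive order vanish at `ω`
  have hvan : ∀ k, iteratedDeriv (k + 1) f ω = 0 := by
    intro k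
    induction k with
    | zero =>
      have h1 := (h𝒯 _ (hiter 0)).2.2.2 ω (Metric.mem_ball_self hr) D hDE
      rw [iteratedDeriv_zero, hfω, hcd D hD] at h1
      rw [iteratedDeriv_succ, iteratedDeriv_zero]
      exact (mul_eq_zero.mp h1.symm).resolve_right hDω
    | succ k ih =>
      have h1 := (h𝒯 _ (hiter (k + 1))).2.2.2 ω (Metric.mem_ball_self hr) D hDE
      rw [ih, map_zero] at h1
      rw [iteratedDeriv_succ]
      exact (mul_eq_zero.mp h1.symm).resolve_right hDω
  -- Taylor: `f ≡ c` on the disc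
  have hconst : ∀ z ∈ Metric.ball ω r, f z = c := by
    intro z hz
    have hsum := Complex.hasSum_taylorSeries_on_ball (h𝒯 f hf𝒯).1 hz
    have hsum0 : HasSum (fun n : ℕ => ((Nat.factorial n : ℂ))⁻¹ • (z - ω) ^ n • iteratedDeriv n f ω)
        (f ω) := by
      have h := hasSum_single (f := fun n : ℕ =>
        ((Nat.factorial n : ℂ))⁻¹ • (z - ω) ^ n • iteratedDeriv n f ω) 0 (by
          intro n hn
          obtain ⟨k, rfl⟩ := Nat.exists_eq_succ_of_ne_zero hn
          simp [hvan k])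
      simpa [iteratedDeriv_zero] using h
    rw [← hfω]
    exact hsum.unique hsum0
  -- evaluate at an algebraic point of the disc
  obtain ⟨α, hαball, hαalg⟩ := exists_isAlgebraic_mem_ball ω hr
  rw [← hconst α hαball]
  exact eaFibre_le_kernelFreeCore_of_isAlgebraic hαalg ((h𝒯 f hf𝒯).2.2.1 α hαball)

open Submodule in
/-- **THE GENERIC-FIBRE THEOREM** (unconditional): at every generic parameter `ω ∉ dcl ∅` the fibre
`F_ω` satisfies RELATIVE SCHANUEL over the kernel-free core `M`: tuples from `F_ω` that are
`ℚ`-linearly independent modulo `M` have `n ≤ trdeg_M M(x, eˣ)` — the family statement whose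
excluded kernel-fibre instance `ω = 2πi` is stub B of the line. From NoHiddenConstants and Kirby's
relative Schanuel theorem over `ecl ∅` (tree, PROVED: `kirby_relative_schanuel_complex_holds`): a
tuple of `F_ω` independent modulo `M` is independent modulo `ecl ∅` (a rational combination in
`ecl ∅ ⊆ dcl ∅` lies in `F_ω ∩ dcl ∅ ⊆ M`), so `n ≤ trdeg` over `ℚ(ecl ∅)`, and base change to the
smaller base `M ≤ ℚ(ecl ∅)` only raises the transcendence degree (`trdeg_adjoin_le_of_le`). -/
theorem relSchanuel_eaFibre_of_not_mem_dcl {ω : ℂ} (hω : ω ∉ dcl (∅ : Set ℂ)) (n : ℕ)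
    (x : Fin n → ℂ) (hxF : ∀ i, x i ∈ eaFibre ω)
    (hxM : LinearIndependent ℚ ((Submodule.span ℚ (kernelFreeCore : Set ℂ)).mkQ ∘ x)) :
    (n : Cardinal) ≤ Algebra.trdeg ↥kernelFreeCore
      ↥(IntermediateField.adjoin ↥kernelFreeCore (Set.range x ∪ Set.range (Complex.exp ∘ x))) := by
  -- `ecl ∅` as an intermediate field, EA-closed (Kirby Lemma 3.3 / §7, tree)
  let E : IntermediateField ℚ ℂ :=
    (Khovanskii.eclSubfield (∅ : Set ℂ)).toIntermediateField fun q => by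
      rw [Khovanskii.eclSubfield]
      show (algebraMap ℚ ℂ q) ∈ ecl (∅ : Set ℂ)
      rw [show algebraMap ℚ ℂ q = (q : ℂ) from rfl]
      exact Literature.Barriers.Schanuel.ratCast_mem_ecl ∅ q
  have hEcoe : (E : Set ℂ) = ecl (∅ : Set ℂ) := rfl
  have hEexp : ∀ w ∈ E, Complex.exp w ∈ E := fun w hw => Khovanskii.exp_mem_ecl hw
  have hEalg : ∀ w : ℂ, IsAlgebraic E w → w ∈ E := by
    intro w hw
    obtain ⟨p, hp0, hpw⟩ := hw
    show w ∈ ecl (∅ : Set ℂ)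
    refine Khovanskii.mem_ecl_of_isRoot (p := p.map (algebraMap E ℂ)) ?_ ?_ ?_
    · exact (Polynomial.map_ne_zero_iff (algebraMap E ℂ).injective).mpr hp0
    · intro k
      rw [Polynomial.coeff_map]
      exact (p.coeff k).2
    · rw [Polynomial.IsRoot, Polynomial.eval_map, ← Polynomial.aeval_def, hpw]
  have hME : kernelFreeCore ≤ E := kernelFreeCore_le hEexp hEalg
  let Mq : Submodule ℚ ℂ := Subalgebra.toSubmodule kernelFreeCore.toSubalgebra
  have hspanM : span ℚ (kernelFreeCore : Set ℂ) = Mq := span_eq Mq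
  let Fq : Submodule ℚ ℂ := Subalgebra.toSubmodule (eaFibre ω).toSubalgebra
  let Eq : Submodule ℚ ℂ := Subalgebra.toSubmodule E.toSubalgebra
  have hspanE : span ℚ (ecl (∅ : Set ℂ)) = Eq := by rw [← hEcoe]; exact span_eq Eq
  have hVF : span ℚ (Set.range x) ≤ Fq := span_le.mpr (Set.range_subset_iff.mpr hxF)
  -- independence modulo `M` ⟹ independence modulo `ecl ∅`
  have hdisjM : Disjoint (span ℚ (Set.range x)) Mq := by
    have h := Submodule.range_ker_disjoint hxM
    rwa [ker_mkQ, hspanM] at h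
  have hxE : LinearIndependent ℚ ((span ℚ (ecl (∅ : Set ℂ))).mkQ ∘ x) := by
    refine (LinearIndependent.of_comp _ hxM).map ?_
    rw [ker_mkQ, hspanE, disjoint_def]
    intro a haV haE
    have haM : a ∈ kernelFreeCore :=
      mem_kernelFreeCore_of_mem_eaFibre_of_mem_dcl hω (hVF haV) (ecl_subset_dcl (∅ : Set ℂ) haE)
    exact (disjoint_def.mp hdisjM) a haV haM
  -- Kirby's theorem over `ecl ∅`, then base change down to `M`
  have hK := kirby_relative_schanuel_complex_holds n x hxE
  have hle : kernelFreeCore ≤ IntermediateField.adjoin ℚ (ecl (∅ : Set ℂ)) :=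
    hME.trans fun a ha => IntermediateField.subset_adjoin ℚ _ ha
  exact hK.trans (trdeg_adjoin_le_of_le hle _)

/-- WHY THE KERNEL FIBRE IS LEFT OVER (barrier `AxSchanuelFunctionalNotNumerical`, honoured): the
period `2πi` lies in `dcl ∅` — every E-derivation kills it (`e^{2πi} = 1`) — so the generic-fibre
theorem says nothing at `ω = 2πi`; that instance is exactly stub B of the line. -/
theorem two_pi_I_mem_dcl_empty : (2 * ↑Real.pi * Complex.I : ℂ) ∈ dcl (∅ : Set ℂ) := by
  intro D hD
  have h := hD.1 (2 * ↑Real.pi * Complex.I)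
  rw [show Literature.ModelTheory.ExponentialFields.ExponentialRing.exp (2 * ↑Real.pi * Complex.I) =
      Complex.exp (2 * ↑Real.pi * Complex.I) from rfl, Complex.exp_two_pi_mul_I, one_mul] at h
  rw [← h]
  exact D.map_one_eq_zero

end GenericFibre

/-! ## The registered landing forms (signatures verbatim; `eaFibre`/`kernelFreeCore` are these `sInf`s by `rfl`) -/

section Stubs

open Literature.NumberTheory.Transcendental

/-- **Stub NHC of line `generic-period-fibre`** (registered on `stmt-Schanuel-0970`): NO HIDDEN
CONSTANTS — at a generic parameter `ω ∉ dcl ∅`, every element of the fibre `F_ω` lying in `dcl ∅`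
lies in the kernel-free core `M`. -/
theorem stub_noHiddenConstants :
    ∀ ω : ℂ, ω ∉ Literature.NumberTheory.Transcendental.dcl (∅ : Set ℂ) →
      ∀ c ∈ (sInf {K : IntermediateField ℚ ℂ | ω ∈ K ∧ (∀ w ∈ K, Complex.exp w ∈ K) ∧
        ∀ w : ℂ, IsAlgebraic K w → w ∈ K} : IntermediateField ℚ ℂ),
        c ∈ Literature.NumberTheory.Transcendental.dcl (∅ : Set ℂ) →
          c ∈ (sInf {K : IntermediateField ℚ ℂ | (∀ w ∈ K, Complex.exp w ∈ K) ∧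
            ∀ w : ℂ, IsAlgebraic K w → w ∈ K} : IntermediateField ℚ ℂ) :=
  fun _ hω _ hc hcd => mem_kernelFreeCore_of_mem_eaFibre_of_mem_dcl hω hc hcd

/-- **Stub GF of line `generic-period-fibre`** (registered on `stmt-Schanuel-0970`): THE
GENERIC-FIBRE THEOREM — relative Schanuel of the generic fibre `F_ω` (`ω ∉ dcl ∅`) over the
kernel-free core `M`. -/
theorem stub_genericFibre :
    ∀ ω : ℂ, ω ∉ Literature.NumberTheory.Transcendental.dcl (∅ : Set ℂ) →
      ∀ (n : ℕ) (x : Fin n → ℂ),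
        (∀ i, x i ∈ (sInf {K : IntermediateField ℚ ℂ | ω ∈ K ∧ (∀ w ∈ K, Complex.exp w ∈ K) ∧
          ∀ w : ℂ, IsAlgebraic K w → w ∈ K} : IntermediateField ℚ ℂ)) →
        LinearIndependent ℚ ((Submodule.span ℚ ((sInf {K : IntermediateField ℚ ℂ |
          (∀ w ∈ K, Complex.exp w ∈ K) ∧ ∀ w : ℂ, IsAlgebraic K w → w ∈ K} :
            IntermediateField ℚ ℂ) : Set ℂ)).mkQ ∘ x) →
          (n : Cardinal) ≤ Algebra.trdeg
            ↥(sInf {K : IntermediateField ℚ ℂ | (∀ w ∈ K, Complex.exp w ∈ K) ∧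
              ∀ w : ℂ, IsAlgebraic K w → w ∈ K} : IntermediateField ℚ ℂ)
            ↥(IntermediateField.adjoin
              ↥(sInf {K : IntermediateField ℚ ℂ | (∀ w ∈ K, Complex.exp w ∈ K) ∧
                ∀ w : ℂ, IsAlgebraic K w → w ∈ K} : IntermediateField ℚ ℂ)
              (Set.range x ∪ Set.range (Complex.exp ∘ x))) :=
  fun _ hω n x hxF hxM => relSchanuel_eaFibre_of_not_mem_dcl hω n x hxF hxM

end Stubs

end Summit.Schanuel.Schanuel.Theorems.RigidCore

end
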